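/- Free-seat work of EXTRA WIDTH SEAT `ym-line-cbag-p1-w5` (prover-ym-line-cbag-p1-w5-g2-0), route `EguchiKawaiDirectionLadder`
(ideator ym-idea-2, LINE 8), crux `TripleSmallBallMargin` (stmt-QuantumFields-27724): the registered stub (a) `FreeTripleSmallBall`
is FALSE AS TYPED — for the trivial reason that it quantifies over ALL `t > 0` and ALL `η > 0`, while the reduced action is bounded
(`S_R ≤ d²`), so for `η > 3/4` and large `t` the claimed bound `exp(N²((3/4 − η) log t + C)) < 1 = ekHaar{S_R ≤ t}`.  The REPAIRED stub
(a′) adds `t ≤ 1 →` (as the skeleton's `ProfileResolvedBound` already does); nothing else in the line changes.  This file is a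
helper (negative knowledge about a stub), not a refutation of the crux; the Yang–Mills mass gap is untouched. -/
import Summits.QuantumFields.YangMills.Theorems.EguchiKawaiDirectionLadderTripleSmallBallMarginDefs

/-!
# Route `EguchiKawaiDirectionLadder`, crux `TripleSmallBallMargin`: stub (a) `FreeTripleSmallBall` is misstated (false at large `t`)

`FreeTripleSmallBall` (objects file `EguchiKawaiDirectionLadderTripleSmallBallMarginDefs`, verbatim from the registered skeleton):
`∀ η > 0, ∃ C ≥ 0, ∃ N₀, ∀ N ≥ N₀, ∀ t > 0, ekHaar 3 N {S_R ≤ t} ≤ exp(N²((3/4 − η) log t + C))`.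

* `ekAction_le_sq` — the reduced action of ANY configuration satisfies `0 ≤ S_R ≤ d²` (each of the `d(d−1) ≤ d²` plaquette terms
  `(1 − Re tr(U_ν†U_μ†U_νU_μ)/N)/2` lies in `[0, 1]` since `|Re tr W| ≤ N` for unitary `W`);
* `not_freeTripleSmallBall` — hence `¬ FreeTripleSmallBall`: with `η = 1`, `N = max N₀ 1`, `t = exp(8C + 12) ≥ 9`, the event
  `{S_R ≤ t}` is everything (measure `1`) but the bound is `exp(N²(−C − 3)) < 1`.

REPAIR (for the planner; not registered here): (a′) `… ∀ t, 0 < t → t ≤ 1 → ekHaar 3 N {S_R ≤ t} ≤ exp(N²((3/4 − η) log t + C))`;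
the witness above has `t > 1` and misses (a′).  The same remark applies verbatim to any rank-robust retyping (a♯) that keeps `∀ t > 0`.
-/

set_option autoImplicit false

noncomputable section

open MeasureTheory
open Literature.Barriers.QuantumFields

namespace Summit.QuantumFields.YangMills.Theorems.EguchiKawaiDirectionLadder

/-- `Re tr W ≥ −N` for a unitary `W` (apply the tree's `re_trace_le` to the unitary `−W`). -/
theorem neg_le_re_trace {N : ℕ} (W : UN N) : -(N : ℝ) ≤ (Matrix.trace (W : Matrix (Fin N) (Fin N) ℂ)).re := by
  have h := re_trace_le (-W)
  have hneg : ((-W : UN N) : Matrix (Fin N) (Fin N) ℂ) = -(W : Matrix (Fin N) (Fin N) ℂ) := rfl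
  rw [hneg, Matrix.trace_neg, Complex.neg_re] at h
  linarith

/-- **The reduced action is bounded: `S_R ≤ d²`** (every plaquette term lies in `[0, 1]`). -/
theorem ekAction_le_sq {d N : ℕ} (U : EKConfig d N) : ekAction U ≤ (d : ℝ) ^ 2 := by
  unfold ekAction
  have hterm : ∀ μ ν : Fin d, (if μ = ν then (0 : ℝ) else (1 - (ekPlaqTrace U μ ν).re / N) / 2) ≤ 1 := by
    intro μ ν
    split_ifs
    · norm_num
    · have h := neg_le_re_trace ((U ν)⁻¹ * (U μ)⁻¹ * U ν * U μ)
      have hre : -(N : ℝ) ≤ (ekPlaqTrace U μ ν).re := by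
        unfold ekPlaqTrace
        convert h using 3
        simp [Matrix.star_eq_conjTranspose]
      rcases Nat.eq_zero_or_pos N with h0 | hpos
      · subst h0; norm_num
      · have hN : (0 : ℝ) < N := by exact_mod_cast hpos
        have : -1 ≤ (ekPlaqTrace U μ ν).re / N := by
          rw [le_div_iff₀ hN]; linarith
        linarith
  calc ∑ μ : Fin d, ∑ ν : Fin d, (if μ = ν then (0 : ℝ) else (1 - (ekPlaqTrace U μ ν).re / N) / 2)
      ≤ ∑ _μ : Fin d, ∑ _ν : Fin d, (1 : ℝ) := Finset.sum_le_sum fun μ _ => Finset.sum_le_sum fun ν _ => hterm μ ν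
    _ = (d : ℝ) ^ 2 := by simp [sq]

/-- **Stub (a) `FreeTripleSmallBall` is false as typed** (large-`t` witness: `η = 1`, `N = max N₀ 1`, `t = e^{8C+12}`):
the event `{S_R ≤ t}` is the whole space for `t ≥ 9`, of `ekHaar`-measure `1`, while the asserted bound is
`exp(N²(−C − 3)) < 1`.  The repaired statement restricts to `0 < t ≤ 1` (as `ProfileResolvedBound` does); this witness
misses it. -/
theorem not_freeTripleSmallBall : ¬ FreeTripleSmallBall := by
  intro h
  obtain ⟨C, hC, N₀, hN⟩ := h 1 one_pos
  set N : ℕ := max N₀ 1 with hNdef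
  have hN1 : 1 ≤ N := le_max_right _ _
  set t : ℝ := Real.exp (8 * C + 12) with htdef
  have ht : 0 < t := Real.exp_pos _
  have hbound := hN N (le_max_left _ _) t ht
  -- the event is everything: S_R ≤ 9 ≤ t
  have ht9 : (9 : ℝ) ≤ t := by
    have h1 : (9 : ℝ) ≤ 8 * C + 12 + 1 := by linarith
    exact h1.trans (by simpa [htdef] using Real.add_one_le_exp (8 * C + 12))
  have huniv : {U : EKConfig 3 N | ekAction U ≤ t} = Set.univ := by
    refine Set.eq_univ_of_forall fun U => ?_
    have hU := ekAction_le_sq U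
    show ekAction U ≤ t
    norm_num at hU
    linarith
  rw [huniv, measure_univ] at hbound
  -- the bound is < 1
  have hlog : Real.log t = 8 * C + 12 := by rw [htdef, Real.log_exp]
  have hneg : (N : ℝ) ^ 2 * ((3 / 4 - 1) * Real.log t + C) < 0 := by
    rw [hlog]
    have hN2 : (1 : ℝ) ≤ (N : ℝ) ^ 2 := by
      have : (1 : ℝ) ≤ N := by exact_mod_cast hN1
      nlinarith
    nlinarith
  have hlt : ENNReal.ofReal (Real.exp ((N : ℝ) ^ 2 * ((3 / 4 - 1) * Real.log t + C))) < 1 := by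
    rw [← ENNReal.ofReal_one]
    exact (ENNReal.ofReal_lt_ofReal_iff_of_nonneg (Real.exp_pos _).le).mpr
      (by simpa using Real.exp_lt_one_iff.mpr hneg |>.trans_le le_rfl)
  exact absurd (lt_of_le_of_lt hbound hlt) (lt_irrefl 1)

end Summit.QuantumFields.YangMills.Theorems.EguchiKawaiDirectionLadder

end
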